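import Summits.BirchSwinnertonDyer.BirchSwinnertonDyer.Theorems.ClassRecordThreeRegCertKernelLog
import HarnessLib

/-!
# Route `ClassRecordThree`, crux `SchneiderAtThree` (item 19106): SECOND-ORDER ingredients of the REG3CERT kernel
# evaluator — the Iwasawa series to three terms, `s_k(q) = q + O(q²)`, and `C²` modulo `27`
# (cell `bsd-stepL`, seat `bsd-stepL-reg3-eng` g3; `--supports stmt-BirchSwinnertonDyer-19106`)

HONEST FRAMING: BSD is not proved by any of this; nothing here closes the crux; Schneider's conjecture (barrier
`PAdicHeightNondegeneracy`) is asserted NOWHERE. The first-order checkers (`…RegCertKernel*`) decide a REG3CERT row whose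
height has `v₃(h(Q)) = 1` (444 of the 723 TRUE-OPEN non-split (ram) X11b@3 rows). Rows with `v₃(h(Q)) = 2` (209 rows)
need `h` modulo `27`, i.e. every link of the chain one `3`-adic digit further. This file supplies the three analytic
inputs that are new at that order, for `p = 3`:

* §1 `norm_padicLogSeries_add_cubic_le`: `‖L(y) + (t + t²/2 + t³/3)‖ ≤ ‖t‖⁴` for `t = 1 − y`, `‖t‖ ≤ 3⁻¹` (the tree's
  `norm_padicLogSeries_add_le` is the one-term version);
* §2 `norm_tateS_sub_self_le`: `‖s_k(q) − q‖ ≤ ‖q‖²` (`s_k(q) = Σ σ_k(n)qⁿ`, every term after the first);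
* §3 `norm_uniformisationScaleSq_sub_le_o2`: `‖C² − γ‖ ≤ 3⁻³` from `27 ∣ c₄·c₄³ + γ·c₆·(c₄³ + 240Δ)` when
  `‖q − Δ/c₄³‖ ≤ 3⁻²` (THE Tate parameter: `1/j(q) = q + O(q²)`, `1/j(W) = Δ/c₄³`) — at this order `q` enters through
  `c₄(E_q) = 1 + 240 s₃(q) ≡ 1 + 240q`.

Theorems only (0 defs, 0 facts). References: [Iwasawa1972PadicL] §4.4; [SilvermanATAEC1994] V.1, V.3, V.5.1;
[SteinWuthrich2013] §4.2.
-/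

open scoped Classical
open scoped ArithmeticFunction.sigma

open WeierstrassCurve Literature.NumberTheory.EllipticCurves
  Literature.NumberTheory.EllipticCurves.SteinWuthrich2013

namespace Summit.BirchSwinnertonDyer.Rank1Residual.X11b.RegMult.KernelCert

/-! ### §0 Plumbing -/

/-- `n + 6 ≤ 3^{n+2}`. [folklore] -/
private theorem add_six_le_three_pow (n : ℕ) : n + 6 ≤ 3 ^ (n + 2) := by
  induction n with
  | zero => norm_num
  | succ k ih =>
    have h : 3 ^ (k + 1 + 2) = 3 * 3 ^ (k + 2) := by ring
    omega

/-- `‖1/(n+4)‖₃ ≤ 3ⁿ` (`n + 4 = 4, 5` are units; `‖1/m‖₃ ≤ m ≤ 3^{m−4}` for `m ≥ 6`). [folklore] -/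
private theorem norm_inv_natCast_add_four_le (n : ℕ) : ‖(((n + 4 : ℕ) : ℚ_[3]))⁻¹‖ ≤ (3 : ℝ) ^ n := by
  rcases Nat.lt_or_ge n 2 with hn | hn
  · have hunit : ‖(((n + 4 : ℕ) : ℚ_[3]))⁻¹‖ = 1 := by
      rw [norm_inv, Padic.norm_eq_zpow_neg_valuation (by exact_mod_cast (show (n + 4 : ℕ) ≠ 0 by omega)),
        Padic.valuation_natCast, padicValNat.eq_zero_of_not_dvd (by interval_cases n <;> norm_num)]
      simp
    rw [hunit]; exact one_le_pow₀ (by norm_num)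
  · obtain ⟨k, rfl⟩ : ∃ k, n = k + 2 := ⟨n - 2, by omega⟩
    have hm : ‖(((k + 2 + 4 : ℕ) : ℚ_[3]))⁻¹‖ ≤ ((k + 2 + 4 : ℕ) : ℝ) := padic_norm_inv_natCast_le _
    have hpow : ((k + 2 + 4 : ℕ) : ℝ) ≤ (3 : ℝ) ^ (k + 2) := by
      have := add_six_le_three_pow k
      rw [show k + 2 + 4 = k + 6 by ring]; exact_mod_cast this
    exact hm.trans hpow

/-! ### §1 The Iwasawa series to three terms -/

/-- **`L(y) = −t − t²/2 − t³/3 + O(‖t‖⁴)`** (`t = 1 − y`, `‖t‖₃ ≤ 3⁻¹`): `‖padicLogSeries 3 y + (t + t²/2 + t³/3)‖ ≤ ‖t‖⁴`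
(terms `tᵐ/m`, `m ≥ 4`, have norm `≤ ‖t‖⁴·‖1/m‖·‖t‖^{m−4} ≤ ‖t‖⁴`). [cite: Iwasawa1972PadicL, §4.4] -/
theorem norm_padicLogSeries_add_cubic_le {y : ℚ_[3]} (ht : ‖1 - y‖ ≤ 1 / 3) :
    ‖padicLogSeries 3 y + ((1 - y) + (1 - y) ^ 2 / 2 + (1 - y) ^ 3 / 3)‖ ≤ ‖1 - y‖ ^ 4 := by
  set t := 1 - y with htdef
  have ht1 : ‖t‖ < 1 := ht.trans_lt (by norm_num)
  have hsum := summable_padicLogSeries_term (p := 3) ht1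
  have hsplit := hsum.sum_add_tsum_nat_add 3
  have hthree : ∑ i ∈ Finset.range 3, -(t ^ (i + 1)) / ((i : ℚ_[3]) + 1) = -(t + t ^ 2 / 2 + t ^ 3 / 3) := by
    simp only [Finset.sum_range_succ, Finset.sum_range_zero]
    push_cast; ring
  have hdef : padicLogSeries 3 y = ∑' n : ℕ, -(t ^ (n + 1)) / ((n : ℚ_[3]) + 1) := by rw [padicLogSeries]
  rw [hdef, ← hsplit, hthree, neg_add_cancel_comm]
  refine IsUltrametricDist.norm_tsum_le_of_forall_le_of_nonneg (by positivity) fun n ↦ ?_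
  have he : -(t ^ (n + 3 + 1)) / (((n + 3 : ℕ) : ℚ_[3]) + 1) = -(t ^ (n + 4) * (((n + 4 : ℕ) : ℚ_[3]))⁻¹) := by
    push_cast; ring
  rw [he, norm_neg, norm_mul, norm_pow]
  calc ‖t‖ ^ (n + 4) * ‖(((n + 4 : ℕ) : ℚ_[3]))⁻¹‖ ≤ ‖t‖ ^ (n + 4) * (3 : ℝ) ^ n := by
        gcongr; exact norm_inv_natCast_add_four_le n
    _ = ‖t‖ ^ 4 * (‖t‖ ^ n * (3 : ℝ) ^ n) := by ring
    _ ≤ ‖t‖ ^ 4 * ((1 / 3 : ℝ) ^ n * (3 : ℝ) ^ n) := by gcongr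
    _ = ‖t‖ ^ 4 := by rw [← mul_pow]; norm_num

/-! ### §2 `s_k(q) = q + O(q²)` -/

/-- **`‖s_k(q) − q‖ ≤ ‖q‖²`** for `‖q‖ < 1` in `ℚ₃` (`s_k(q) = q + Σ_{n≥2} σ_k(n)qⁿ`, each later term of norm `≤ ‖q‖ⁿ`).
[cite: SilvermanATAEC1994, Ch. V §1 (1.1)(b)] -/
theorem norm_tateS_sub_self_le (k : ℕ) {q : ℚ_[3]} (hq : ‖q‖ < 1) : ‖tateS k q - q‖ ≤ ‖q‖ ^ 2 := by
  have hsum := TateCurve.summable_tateS_term k hq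
  have hsplit := hsum.sum_add_tsum_nat_add 1
  have hone : ∑ i ∈ Finset.range 1, ((σ k (i + 1) : ℕ) : ℚ_[3]) * q ^ (i + 1) = q := by
    simp [ArithmeticFunction.sigma_one]
  have hdef : tateS k q = ∑' n : ℕ, ((σ k (n + 1) : ℕ) : ℚ_[3]) * q ^ (n + 1) := by rw [tateS]
  rw [hdef, ← hsplit, hone, add_sub_cancel_left]
  refine IsUltrametricDist.norm_tsum_le_of_forall_le_of_nonneg (sq_nonneg _) fun n ↦ ?_
  rw [norm_mul, norm_pow]
  calc ‖((σ k (n + 1 + 1) : ℕ) : ℚ_[3])‖ * ‖q‖ ^ (n + 1 + 1) ≤ 1 * ‖q‖ ^ (n + 1 + 1) := by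
        gcongr; exact norm_natCast_le_one (p := 3) _
    _ = ‖q‖ ^ 2 * ‖q‖ ^ n := by ring
    _ ≤ ‖q‖ ^ 2 * 1 := by gcongr; exact pow_le_one₀ (norm_nonneg _) hq.le
    _ = ‖q‖ ^ 2 := mul_one _

/-! ### §3 `C²` modulo `27` -/

/-- **`C² ≡ −c₄⁴/(c₆(c₄³ + 240Δ)) (mod 27)`.** For any `W/ℚ` with `c₄, c₆` `3`-adic units (read in `ℚ₃`), any
integer `γ` with `27 ∣ c₄·c₄³ + γ·c₆·(c₄³ + 240·Δ)` (`Δ` an integer with `3 ∣ Δ`), and any `q ∈ ℚ₃` with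
`‖q − Δ/c₄³‖ ≤ 3⁻²` (THE Tate parameter when `1/j(W) = Δ/c₄³`, ATAEC V.5.1): `‖uniformisationScaleSq W 3 q − γ‖ ≤ 3⁻³`.
Here `c₄(E_q) = 1 + 240 s₃(q)` with `s₃(q) ≡ q ≡ Δ/c₄³ (mod 9)` and `c₆(E_q) = −1 + 504 s₅(q) ≡ −1 (mod 27)`.
[cite: SteinWuthrich2013, §4.2] [cite: SilvermanATAEC1994, Thm. V.3.1 and Lemma V.5.1] -/
theorem norm_uniformisationScaleSq_sub_le_o2 (W : WeierstrassCurve ℚ) {c4 c6 D γ : ℤ}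
    (hc4 : (W.baseChange ℚ_[3]).c₄ = c4) (hc6 : (W.baseChange ℚ_[3]).c₆ = c6) (h3c4 : ¬ (3 : ℤ) ∣ c4)
    (h3c6 : ¬ (3 : ℤ) ∣ c6) (h3D : (3 : ℤ) ∣ D) (hγ : (27 : ℤ) ∣ c4 * c4 ^ 3 + γ * c6 * (c4 ^ 3 + 240 * D))
    {q : ℚ_[3]} (hq : ‖q - (D : ℚ_[3]) / (c4 : ℚ_[3]) ^ 3‖ ≤ 1 / 9) :
    ‖uniformisationScaleSq W 3 q - γ‖ ≤ 1 / 27 := by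
  have hc4n : ‖(c4 : ℚ_[3])‖ = 1 := norm_intCast_eq_one_of_not_dvd h3c4
  have hc6n : ‖(c6 : ℚ_[3])‖ = 1 := norm_intCast_eq_one_of_not_dvd h3c6
  have hJn : ‖(c4 : ℚ_[3]) ^ 3‖ = 1 := by rw [norm_pow, hc4n, one_pow]
  have hc40 : (c4 : ℚ_[3]) ≠ 0 := by intro h; rw [h, norm_zero] at hc4n; exact zero_ne_one hc4n
  have hJ0 : (c4 : ℚ_[3]) ^ 3 ≠ 0 := by intro h; rw [h, norm_zero] at hJn; exact zero_ne_one hJn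
  have hDn : ‖(D : ℚ_[3])‖ ≤ 1 / 3 := (norm_intCast_le_of_pow_dvd (k := 1) (by simpa using h3D)).trans (by norm_num)
  set q0 : ℚ_[3] := (D : ℚ_[3]) / (c4 : ℚ_[3]) ^ 3 with hq0
  have hq0n : ‖q0‖ ≤ 1 / 3 := by rw [hq0, norm_div, hJn, div_one]; exact hDn
  have hqn : ‖q‖ ≤ 1 / 3 := by
    have : q = (q - q0) + q0 := by ring
    rw [this]; exact (IsUltrametricDist.norm_add_le_max _ _).trans (max_le (hq.trans (by norm_num)) hq0n)
  have hq1 : ‖q‖ < 1 := hqn.trans_lt (by norm_num)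
  have hs3 : ‖tateS 3 q - q0‖ ≤ 1 / 9 := by
    have : tateS 3 q - q0 = (tateS 3 q - q) + (q - q0) := by ring
    rw [this]
    refine (IsUltrametricDist.norm_add_le_max _ _).trans (max_le ((norm_tateS_sub_self_le 3 hq1).trans ?_) hq)
    calc ‖q‖ ^ 2 ≤ (1 / 3) ^ 2 := by gcongr
      _ = 1 / 9 := by norm_num
  have hs3n : ‖tateS 3 q‖ ≤ 1 / 3 := (TateCurve.norm_tateS_le hq1.le).trans hqn
  have hs5 : ‖tateS 5 q‖ ≤ 1 / 3 := (TateCurve.norm_tateS_le hq1.le).trans hqn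
  have h12 : (12 : ℚ_[3]) ≠ 0 := by norm_num
  rw [uniformisationScaleSq, TateCurve.tateCurve_c₄, TateCurve.tateCurve_c₆ h12, hc4, hc6, TateCurve.tateE4_eq,
    TateCurve.tateE6]
  set s3 := tateS 3 q
  set s5 := tateS 5 q
  have hγn : ‖(γ : ℚ_[3])‖ ≤ 1 := Padic.norm_int_le_one _
  have h240 : ‖(240 : ℚ_[3])‖ ≤ 1 / 3 := by
    rw [show (240 : ℚ_[3]) = ((240 : ℤ) : ℚ_[3]) by norm_cast]
    exact (norm_intCast_le_of_pow_dvd (k := 1) (by norm_num)).trans (by norm_num)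
  have h504 : ‖(504 : ℚ_[3])‖ ≤ 1 / 9 := by
    rw [show (504 : ℚ_[3]) = ((504 : ℤ) : ℚ_[3]) by norm_cast]
    exact (norm_intCast_le_of_pow_dvd (k := 2) (by norm_num)).trans (by norm_num)
  have hD : ‖(1 + 240 * s3) * (c6 : ℚ_[3])‖ = 1 := by
    have hsub : ‖(1 + 240 * s3) * (c6 : ℚ_[3]) - c6‖ < ‖(c6 : ℚ_[3])‖ := by
      rw [hc6n, show (1 + 240 * s3) * (c6 : ℚ_[3]) - c6 = 240 * s3 * c6 by ring, norm_mul, norm_mul, hc6n]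
      calc ‖(240 : ℚ_[3])‖ * ‖s3‖ * 1 ≤ 1 / 3 * (1 / 3) * 1 := by gcongr
        _ < 1 := by norm_num
    rw [Padic.norm_eq_of_norm_sub_lt_right hsub, hc6n]
  have hD0 : (1 + 240 * s3) * (c6 : ℚ_[3]) ≠ 0 := by
    intro h; rw [h, norm_zero] at hD; exact zero_ne_one hD
  rw [div_sub' hD0, norm_div, hD, div_one]
  have hnum : -(1 - 504 * s5) * (c4 : ℚ_[3]) - (1 + 240 * s3) * (c6 : ℚ_[3]) * (γ : ℚ_[3]) =
      -((((c4 * c4 ^ 3 + γ * c6 * (c4 ^ 3 + 240 * D) : ℤ)) : ℚ_[3]) / (c4 : ℚ_[3]) ^ 3) +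
        -(240 * (γ : ℚ_[3]) * (c6 : ℚ_[3]) * (s3 - q0)) + 504 * (c4 : ℚ_[3]) * s5 := by
    rw [hq0]; push_cast; field_simp; ring
  rw [hnum]
  have h1 : ‖-((((c4 * c4 ^ 3 + γ * c6 * (c4 ^ 3 + 240 * D) : ℤ)) : ℚ_[3]) / (c4 : ℚ_[3]) ^ 3)‖ ≤ 1 / 27 := by
    rw [norm_neg, norm_div, hJn, div_one]
    exact (norm_intCast_le_of_pow_dvd (k := 3) (by norm_num; exact hγ)).trans (by norm_num)
  have h2 : ‖-(240 * (γ : ℚ_[3]) * (c6 : ℚ_[3]) * (s3 - q0))‖ ≤ 1 / 27 := by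
    rw [norm_neg, norm_mul, norm_mul, norm_mul, hc6n]
    calc ‖(240 : ℚ_[3])‖ * ‖(γ : ℚ_[3])‖ * 1 * ‖s3 - q0‖ ≤ 1 / 3 * 1 * 1 * (1 / 9) := by gcongr
      _ = 1 / 27 := by norm_num
  have h3 : ‖504 * (c4 : ℚ_[3]) * s5‖ ≤ 1 / 27 := by
    rw [norm_mul, norm_mul, hc4n]
    calc ‖(504 : ℚ_[3])‖ * 1 * ‖s5‖ ≤ 1 / 9 * 1 * (1 / 3) := by gcongr
      _ = 1 / 27 := by norm_num
  refine (IsUltrametricDist.norm_add_le_max _ _).trans (max_le ?_ h3)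
  exact (IsUltrametricDist.norm_add_le_max _ _).trans (max_le h1 h2)

end Summit.BirchSwinnertonDyer.Rank1Residual.X11b.RegMult.KernelCert
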